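/-
Literature file (hubbard-downfold multi-orbital front-end, router branch `UND:MULTIORB(k; J_H)`): the
atomic-limit Mott gap of an `M`-orbital Kanamori shell, `Δ_at(N) = E₀(N+1) + E₀(N−1) − 2E₀(N)`, evaluated
exactly as Georges–de' Medici–Mravlje (2013, §3) do it — by pair counting in the density–density part of
the Kanamori Hamiltonian on the maximal-`S_z` Hund configuration — with the two printed outcomes
`Δ_at = U' − J = U − 3J` away from half filling and `Δ_at = U + (M − 1)J` at half filling
(the «Janus» effect of Hund's coupling; van der Marel–Sawatzky 1988).
-/
import Mathlib
import HarnessLib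

/-!
# The atomic Mott gap of a Kanamori shell: `U − 3J` versus `U + (M − 1)J`

Georges, de' Medici and Mravlje consider an isolated shell of `M` degenerate orbitals with the Kanamori
interaction `H_K = U Σ_m n_{m↑}n_{m↓} + U' Σ_{m≠m'} n_{m↑}n_{m'↓} + (U' − J) Σ_{m<m',σ} n_{mσ}n_{m'σ}
− J (spin-flip) + J (pair-hopping)` and the cost of a charge fluctuation between two such atoms,
`Δ_at := E₀(N+1) + E₀(N−1) − 2E₀(N)` (§3, first displayed equation). They evaluate `E₀` «by considering
simply the density-density terms» on «the state in the (degenerate) ground-state multiplet with maximal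
`S^z`, consistent with Hund's rules» (`|↑,↑,0⟩`, `|↑,↑,↑⟩`, `|↑↓,↑,↑⟩` for `M = 3`, `N = 2, 3, 4`), on which
«the exchange and pair-hopping terms have no action», and count pairs:

* `N ≤ M`: only parallel pairs, `E₀(N) = (U' − J)·N(N−1)/2` (`= (U − 3J)N(N−1)/2` when `U' = U − 2J`);
* `N = M + 1`: `E₀(M+1) = (U' − J)·M(M−1)/2 + U·1 + U'·(M−1)`;

whence (the two further displayed equations of §3)

* `Δ_at ≡ U_eff = U' − J = U − 3J` for `N < M` or `N > M` (particle–hole symmetry) — REDUCED by `J`;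
* `Δ_at ≡ U_eff = (U' − J) + (U − U' + MJ) = U + (M − 1)J` for `N = M` — INCREASED by `J`.

This file formalizes exactly that computation for every `M` and every filling `0 ≤ N ≤ 2M`:
occupation patterns are pairs of `0/1`-valued functions on the orbital labels `m < M`, `ddEnergy` is the
density–density functional above, `hund M N` is the maximal-`S_z` pattern, and the closed forms and gap
formulas are PROVED by finite-sum counting (no modelling input beyond the functional and the pattern).

## Contents (all exact)

* `ddEnergy_hund_le` — `N ≤ M`: `E = (U' − J)·C(N,2)`; `ddEnergy_hund_ge` — `N = M + k`, `k ≤ M`: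
  `E = U·k + U'·k(M−1) + (U' − J)·(C(M,2) + C(k,2))` (the printed `N = M + 1` case is `k = 1`).
* `atomicGap_below` / `atomicGap_above` — `Δ_at(N) = U' − J` for `1 ≤ N ≤ M − 1` and `M + 1 ≤ N ≤ 2M − 1`;
  `atomicGap_half` — `Δ_at(M) = U + (M − 1)J` (for ANY `U'`: the half-filled gap does not see `U'`).
* Rotational invariance `U' = U − 2J` (§2): `atomicGap_below_rot` / `atomicGap_above_rot` give `U − 3J`;
  `janus` — `Δ_at(M) − Δ_at(N) = (M + 2)J` for generic `N`; `groundEnergy_le_rot` — the printed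
  `E₀(N) = (U − 3J)N(N−1)/2`; `groundEnergy_succ_half` — the printed `E₀(M+1)`.
* `mottCriterion_generic` / `mottCriterion_half` — the printed closing criteria `U_c = W̃ + 3J` (`N ≠ M`) and
  `U_c = W̃ − (M − 1)J` (`N = M`) as the rearrangements of `Δ_at = W̃` they are.
* `t2g_gaps` — `M = 3`: `Δ_at = U − 3J, U − 3J, U + 2J, U − 3J, U − 3J` at `N = 1 … 5`;
  `dshell_gaps` — `M = 5`: `U − 3J` at `N = 6` (d⁶, e.g. Fe²⁺) and `U + 4J` at `N = 5` (d⁵).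
* `num_hund` — the pattern `hund M N` carries `N` electrons (`N ≤ 2M`).

WHAT THIS IS NOT: a statement that the Hund pattern is the ground state of the full `H_K` on Fock space
(that is Hund's first rule for this Hamiltonian — GdMM Table 1 for `t₂g` — and is the cited INPUT here, not
re-derived: TODO(general form): second-quantised `H_K` and its spectrum), nor a statement about any
material's `U, J`, nor about the solid (where `U_c = W̃(J) ± …` needs the kinetic term): it is the exact
atomic-limit pair-counting dictionary that the multi-orbital («Hund's metal») literature quotes when it
says that `J` reduces the effective repulsion to `U − 3J` for a non-half-filled shell (pnictides, d⁶ in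
five orbitals) and raises it to `U + (M−1)J` at half filling.

## References

* A. Georges, L. de' Medici, J. Mravlje, *Strong Correlations from Hund's Coupling*, Annu. Rev. Condens.
  Matter Phys. 4 (2013) 137–178, §2 (Kanamori Hamiltonian, `U' = U − 2J`) and §3 «Energetics of the Mott
  gap» (arXiv:1207.3033 pp. 7–8: `Δ_at` definition, `E₀(N)` by pair counting, `U_eff = U − 3J` for `N ≠ M`,
  `U_eff = U + (M−1)J` for `N = M`, `U_c = W̃ + 3J` / `W̃ − (M−1)J`). [GeorgesMediciMravlje2013]
* D. van der Marel, G. A. Sawatzky, Phys. Rev. B 37 (1988) 10674 (the isolated-atom observation, as cited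
  in §3 of the above; full Racah–Slater d-shell expressions there). [cited via GeorgesMediciMravlje2013]
-/

noncomputable section

namespace Literature.MathematicalPhysics.QuantumManyBody

namespace KanamoriAtomicMottGap

open Finset

/-! ## Occupation patterns and the density–density Kanamori functional -/

/-- An occupation pattern of a shell whose orbitals are labelled by naturals `m` (only `m < M` is ever
read): `up m`, `dn m ∈ {0, 1}` are the occupation numbers `n_{m↑}`, `n_{m↓}` of a Slater-determinant
(product) state in the orbital basis. [cite: GeorgesMediciMravlje2013, §3 (the states `|↑,↑,0⟩`, …)] -/
structure Occ where
  /-- `n_{m↑}` -/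
  up : ℕ → ℕ
  /-- `n_{m↓}` -/
  dn : ℕ → ℕ

/-- Number of doubly occupied orbitals `Σ_{m<M} n_{m↑} n_{m↓}` (pairs paying `U`).
[cite: GeorgesMediciMravlje2013, §2 (first term of `H_K`)] -/
def doublons (M : ℕ) (n : Occ) : ℕ := ∑ m ∈ range M, n.up m * n.dn m

/-- Number of opposite-spin pairs in different orbitals `Σ_{m ≠ m'} n_{m↑} n_{m'↓}` (pairs paying `U'`).
[cite: GeorgesMediciMravlje2013, §2 (second term of `H_K`)] -/
def updnPairs (M : ℕ) (n : Occ) : ℕ :=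
  ∑ m ∈ range M, ∑ m' ∈ range M, if m ≠ m' then n.up m * n.dn m' else 0

/-- Number of pairs `Σ_{m < m'} f m · f m'` within one spin species `f` (half of the third term of `H_K`).
[cite: GeorgesMediciMravlje2013, §2 (third term of `H_K`, one value of `σ`)] -/
def samePairs (M : ℕ) (f : ℕ → ℕ) : ℕ :=
  ∑ m' ∈ range M, ∑ m ∈ range M, if m < m' then f m * f m' else 0

/-- Number of parallel-spin pairs `Σ_{m<m', σ} n_{mσ} n_{m'σ}` (pairs paying `U' − J`).
[cite: GeorgesMediciMravlje2013, §2 (third term of `H_K`)] -/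
def parallelPairs (M : ℕ) (n : Occ) : ℕ := samePairs M n.up + samePairs M n.dn

/-- Electron number `N̂ = Σ_{m<M,σ} n_{mσ}`. [cite: GeorgesMediciMravlje2013, §2 (definition of `N̂`)] -/
def num (M : ℕ) (n : Occ) : ℕ := ∑ m ∈ range M, (n.up m + n.dn m)

/-- The density–density part of the Kanamori Hamiltonian evaluated on an occupation pattern:
`E = U Σ_m n_{m↑}n_{m↓} + U' Σ_{m≠m'} n_{m↑}n_{m'↓} + (U' − J) Σ_{m<m',σ} n_{mσ}n_{m'σ}`.
[cite: GeorgesMediciMravlje2013, §2 Eq. for `H_K` (first three terms); §3 «considering simply the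
density-density terms»] -/
def ddEnergy (U U' J : ℝ) (M : ℕ) (n : Occ) : ℝ :=
  U * (doublons M n : ℝ) + U' * (updnPairs M n : ℝ) + (U' - J) * (parallelPairs M n : ℝ)

/-- The Hund (maximal-`S_z`) pattern with `N` electrons in `M` orbitals: orbitals `0, …, N−1` carry an ↑
electron (all `M` of them once `N ≥ M`) and, for `N > M`, orbitals `0, …, N−M−1` carry a ↓ electron as well:
`|↑,↑,0⟩`, `|↑,↑,↑⟩`, `|↑↓,↑,↑⟩` for `M = 3`, `N = 2, 3, 4`.
[cite: GeorgesMediciMravlje2013, §3 («maximal `S^z` (= +N/2 for N ≤ M, = M − N/2 for N ≥ M)»)] -/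
def hund (M N : ℕ) : Occ :=
  ⟨fun m => if m < N then 1 else 0, fun m => if M + m < N then 1 else 0⟩

/-- The atomic charge gap `Δ_at(N) = E₀(N+1) + E₀(N−1) − 2E₀(N)` of the `M`-orbital shell, with `E₀` the
density–density Kanamori energy of the Hund pattern (meaningful for `1 ≤ N ≤ 2M − 1`).
[cite: GeorgesMediciMravlje2013, §3 (first displayed equation)] -/
def atomicGap (U U' J : ℝ) (M N : ℕ) : ℝ :=
  ddEnergy U U' J M (hund M (N + 1)) + ddEnergy U U' J M (hund M (N - 1))
    - 2 * ddEnergy U U' J M (hund M N)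

/-! ## Counting lemmas (finite sums over `range M`) -/

/-- `#{m < M | m < N} = min M N`. [folklore] -/
private lemma sum_range_ite_lt (M N : ℕ) :
    ∑ m ∈ range M, (if m < N then (1 : ℕ) else 0) = min M N := by
  induction M with
  | zero => simp
  | succ M ih =>
    rw [sum_range_succ, ih]
    split_ifs <;> omega

/-- `#{m < M | m < K ∧ m < N} = min M (min K N)`. [folklore] -/
private lemma sum_range_ite_lt_lt (M K N : ℕ) :
    ∑ m ∈ range M, (if m < K then (if m < N then (1 : ℕ) else 0) else 0) = min M (min K N) := by
  induction M with
  | zero => simp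
  | succ M ih =>
    rw [sum_range_succ, ih]
    split_ifs <;> omega

/-- Pascal: `C(n+1, 2) = C(n, 2) + n`. [folklore] -/
private lemma choose_two_succ (n : ℕ) : (n + 1).choose 2 = n.choose 2 + n := by
  have h : (n + 1).choose 2 = n.choose 1 + n.choose 2 := Nat.choose_succ_succ n 1
  rw [Nat.choose_one_right] at h
  omega

/-- Gauss: `Σ_{m < M} [m < N]·m = C(min M N, 2)`. [folklore] -/
private lemma sum_range_ite_lt_id (M N : ℕ) :
    ∑ m ∈ range M, (if m < N then m else 0) = (min M N).choose 2 := by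
  induction M with
  | zero => simp
  | succ M ih =>
    rw [sum_range_succ, ih]
    by_cases h : M < N
    · rw [if_pos h, Nat.min_eq_left (by omega : M + 1 ≤ N), Nat.min_eq_left (by omega : M ≤ N),
        choose_two_succ]
    · rw [if_neg h, Nat.min_eq_right (by omega : N ≤ M + 1), Nat.min_eq_right (by omega : N ≤ M),
        add_zero]

/-- `C(n, 2)` over `ℝ`. [folklore] -/
private lemma cast_choose_two (n : ℕ) : ((n.choose 2 : ℕ) : ℝ) = (n : ℝ) * ((n : ℝ) - 1) / 2 := by
  induction n with
  | zero => simp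
  | succ n ih =>
    rw [choose_two_succ]
    push_cast
    rw [ih]
    ring

/-- Same-spin pair count of the threshold pattern `m ↦ [m < N]`: `C(min M N, 2)`. [folklore] -/
private lemma samePairs_thr (M N : ℕ) :
    samePairs M (fun m => if m < N then 1 else 0) = (min M N).choose 2 := by
  unfold samePairs
  have inner : ∀ m' ∈ range M,
      (∑ m ∈ range M, if m < m' then (if m < N then 1 else 0) * (if m' < N then 1 else 0) else 0)
        = if m' < N then m' else 0 := by
    intro m' hm'
    rw [mem_range] at hm'
    by_cases h' : m' < N
    · simp only [if_pos h', mul_one]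
      rw [sum_range_ite_lt_lt]
      omega
    · simp only [if_neg h', mul_zero, ite_self, sum_const_zero]
  rw [sum_congr rfl inner, sum_range_ite_lt_id]

/-- `Σ_{m < M, m ≠ j} c = (M − 1)·c` for `j < M`. [folklore] -/
private lemma sum_range_ite_ne (M j c : ℕ) (hj : j < M) :
    ∑ m ∈ range M, (if m ≠ j then c else 0) = (M - 1) * c := by
  rw [sum_ite, sum_const_zero, add_zero, sum_const, smul_eq_mul, filter_ne',
    card_erase_of_mem (mem_range.mpr hj), card_range]

/-! ## The two closed forms of GdMM §3 -/

/-- Below (and at) half filling the Hund pattern has only parallel pairs: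
`E₀(N) = (U' − J)·C(N, 2)` for `N ≤ M`.
[cite: GeorgesMediciMravlje2013, §3 («for N ≤ M, the ground-state energy involves only the pairwise
interaction between parallel spins: E₀(N) = (U' − J)N(N−1)/2»)] -/
theorem ddEnergy_hund_le (U U' J : ℝ) {M N : ℕ} (h : N ≤ M) :
    ddEnergy U U' J M (hund M N) = (U' - J) * ((N.choose 2 : ℕ) : ℝ) := by
  have hd : doublons M (hund M N) = 0 := by
    unfold doublons hund
    apply sum_eq_zero
    intro m _
    have : ¬ (M + m < N) := by omega
    simp [this]
  have hu : updnPairs M (hund M N) = 0 := by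
    unfold updnPairs hund
    apply sum_eq_zero
    intro m _
    apply sum_eq_zero
    intro m' _
    have : ¬ (M + m' < N) := by omega
    simp [this]
  have hup : samePairs M (hund M N).up = N.choose 2 := by
    show samePairs M (fun m => if m < N then 1 else 0) = N.choose 2
    rw [samePairs_thr, Nat.min_eq_right h]
  have hdn : samePairs M (hund M N).dn = 0 := by
    have hf : (hund M N).dn = fun m => if m < N - M then 1 else 0 := by
      funext m
      show (if M + m < N then 1 else 0) = if m < N - M then 1 else 0
      split_ifs <;> omega
    rw [hf, samePairs_thr, Nat.sub_eq_zero_of_le h, Nat.min_zero, Nat.choose_zero_succ]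
  unfold ddEnergy parallelPairs
  rw [hd, hu, hup, hdn]
  push_cast
  ring

/-- Above half filling, `N = M + k` with `0 ≤ k ≤ M`: `k` doublons, `k(M − 1)` opposite-spin inter-orbital
pairs, `C(M,2) + C(k,2)` parallel pairs:
`E₀(M+k) = U·k + U'·k(M−1) + (U' − J)·(C(M,2) + C(k,2))`; the printed case is `k = 1`:
`E₀(M+1) = (U' − J)M(M−1)/2 + U·1 + U'·(M−1)`.
[cite: GeorgesMediciMravlje2013, §3 («Counting the number of each types of pairs …»)] -/
theorem ddEnergy_hund_ge (U U' J : ℝ) {M k : ℕ} (hk : k ≤ M) :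
    ddEnergy U U' J M (hund M (M + k))
      = U * k + U' * ((k * (M - 1) : ℕ) : ℝ) + (U' - J) * (((M.choose 2 + k.choose 2 : ℕ)) : ℝ) := by
  have hd : doublons M (hund M (M + k)) = k := by
    unfold doublons hund
    have hc : ∀ m ∈ range M,
        (if m < M + k then 1 else 0) * (if M + m < M + k then 1 else 0) = if m < k then (1 : ℕ) else 0 := by
      intro m hm
      rw [mem_range] at hm
      have h1 : m < M + k := by omega
      rw [if_pos h1, one_mul]
      split_ifs <;> omega
    show (∑ m ∈ range M, (if m < M + k then 1 else 0) * (if M + m < M + k then 1 else 0)) = k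
    rw [sum_congr rfl hc, sum_range_ite_lt, Nat.min_eq_right hk]
  have hu : updnPairs M (hund M (M + k)) = k * (M - 1) := by
    unfold updnPairs hund
    show (∑ m ∈ range M, ∑ m' ∈ range M,
        if m ≠ m' then (if m < M + k then 1 else 0) * (if M + m' < M + k then 1 else 0) else 0)
        = k * (M - 1)
    have hc : ∀ m ∈ range M, (∑ m' ∈ range M,
        if m ≠ m' then (if m < M + k then 1 else 0) * (if M + m' < M + k then 1 else 0) else 0)
          = ∑ m' ∈ range M, if m' ≠ m then (if m' < k then (1 : ℕ) else 0) else 0 := by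
      intro m hm
      rw [mem_range] at hm
      apply sum_congr rfl
      intro m' _
      have h1 : m < M + k := by omega
      rw [if_pos h1, one_mul]
      by_cases hmm : m = m'
      · subst hmm
        simp
      · rw [if_pos hmm, if_pos (Ne.symm hmm)]
        split_ifs <;> omega
    rw [sum_congr rfl hc, sum_comm]
    have hc2 : ∀ m' ∈ range M,
        (∑ m ∈ range M, if m' ≠ m then (if m' < k then (1 : ℕ) else 0) else 0)
          = (M - 1) * (if m' < k then 1 else 0) := by
      intro m' hm'
      rw [mem_range] at hm'
      have hc3 : ∀ m ∈ range M,
          (if m' ≠ m then (if m' < k then (1 : ℕ) else 0) else 0)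
            = if m ≠ m' then (if m' < k then (1 : ℕ) else 0) else 0 := by
        intro m _
        by_cases hmm : m = m'
        · subst hmm; simp
        · rw [if_pos hmm, if_pos (Ne.symm hmm)]
      rw [sum_congr rfl hc3, sum_range_ite_ne M m' _ hm']
    rw [sum_congr rfl hc2, ← mul_sum, sum_range_ite_lt, Nat.min_eq_right hk, mul_comm]
  have hup : samePairs M (hund M (M + k)).up = M.choose 2 := by
    show samePairs M (fun m => if m < M + k then 1 else 0) = M.choose 2
    rw [samePairs_thr, Nat.min_eq_left (by omega : M ≤ M + k)]
  have hdn : samePairs M (hund M (M + k)).dn = k.choose 2 := by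
    have hf : (hund M (M + k)).dn = fun m => if m < k then 1 else 0 := by
      funext m
      show (if M + m < M + k then 1 else 0) = if m < k then 1 else 0
      split_ifs <;> omega
    rw [hf, samePairs_thr, Nat.min_eq_right hk]
  unfold ddEnergy parallelPairs
  rw [hd, hu, hup, hdn]

/-- The Hund pattern `hund M N` indeed carries `N` electrons (`N ≤ 2M`).
[cite: GeorgesMediciMravlje2013, §3 («maximal `S^z` (= +N/2 for N ≤ M, = M − N/2 for N ≥ M)» — the
pattern with `N` electrons)] -/
theorem num_hund {M N : ℕ} (h : N ≤ 2 * M) : num M (hund M N) = N := by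
  unfold num hund
  show (∑ m ∈ range M, ((if m < N then 1 else 0) + (if M + m < N then 1 else 0))) = N
  have hc : ∀ m ∈ range M,
      ((if m < N then 1 else 0) + (if M + m < N then 1 else 0))
        = (if m < N then (1 : ℕ) else 0) + (if m < N - M then 1 else 0) := by
    intro m _
    congr 1
    split_ifs <;> omega
  rw [sum_congr rfl hc, sum_add_distrib, sum_range_ite_lt, sum_range_ite_lt]
  omega

/-! ## The atomic gap: generic filling versus half filling -/

/-- GENERIC FILLING BELOW HALF: for `1 ≤ N ≤ M − 1` (written `N = n + 1`, `n + 2 ≤ M`) the atomic gap is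
`Δ_at = U' − J`, independently of `N` and `M`.
[cite: GeorgesMediciMravlje2013, §3 («Δ_at ≡ U_eff = U' − J = U − 3J (N < M or N > M)»)] -/
theorem atomicGap_below (U U' J : ℝ) {M n : ℕ} (h : n + 2 ≤ M) :
    atomicGap U U' J M (n + 1) = U' - J := by
  unfold atomicGap
  rw [show n + 1 + 1 = n + 2 by ring, show n + 1 - 1 = n by omega,
    ddEnergy_hund_le U U' J (by omega : n + 2 ≤ M), ddEnergy_hund_le U U' J (by omega : n ≤ M),
    ddEnergy_hund_le U U' J (by omega : n + 1 ≤ M), cast_choose_two, cast_choose_two, cast_choose_two]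
  push_cast
  ring

/-- HALF FILLING: for `N = M ≥ 1` the atomic gap is `Δ_at = U + (M − 1)J` — for ANY `U'` (the `U'`
contributions `(U' − J) + (U − U' + MJ)` cancel).
[cite: GeorgesMediciMravlje2013, §3 («Δ_at ≡ U_eff = (U' − J) + (U − U' + MJ) = U + (M−1)J (N = M)»)] -/
theorem atomicGap_half (U U' J : ℝ) {M : ℕ} (hM : 1 ≤ M) :
    atomicGap U U' J M M = U + ((M : ℝ) - 1) * J := by
  obtain ⟨m, rfl⟩ : ∃ m, M = m + 1 := ⟨M - 1, by omega⟩
  unfold atomicGap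
  rw [show m + 1 - 1 = m by omega, ddEnergy_hund_ge U U' J (by omega : 1 ≤ m + 1),
    ddEnergy_hund_le U U' J (by omega : m ≤ m + 1)]
  rw [show (hund (m + 1) (m + 1)) = hund (m + 1) (m + 1 + 0) by rfl,
    ddEnergy_hund_ge U U' J (by omega : 0 ≤ m + 1)]
  have h12 : Nat.choose 1 2 = 0 := by decide
  have h02 : Nat.choose 0 2 = 0 := by decide
  rw [show m + 1 - 1 = m by omega, h12, h02, choose_two_succ]
  push_cast
  ring

/-- GENERIC FILLING ABOVE HALF: for `N = M + k` with `1 ≤ k ≤ M − 1` the atomic gap is again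
`Δ_at = U' − J` (particle–hole symmetry of the count).
[cite: GeorgesMediciMravlje2013, §3 («with the expression for N > M stemming from particle-hole symmetry»)] -/
theorem atomicGap_above (U U' J : ℝ) {M k : ℕ} (hk1 : 1 ≤ k) (hk : k + 1 ≤ M) :
    atomicGap U U' J M (M + k) = U' - J := by
  obtain ⟨j, rfl⟩ : ∃ j, k = j + 1 := ⟨k - 1, by omega⟩
  unfold atomicGap
  rw [show M + (j + 1) + 1 = M + (j + 2) by ring, show M + (j + 1) - 1 = M + j by omega,
    ddEnergy_hund_ge U U' J (by omega : j + 2 ≤ M), ddEnergy_hund_ge U U' J (by omega : j ≤ M),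
    ddEnergy_hund_ge U U' J (by omega : j + 1 ≤ M)]
  obtain ⟨m, rfl⟩ : ∃ m, M = m + 1 := ⟨M - 1, by omega⟩
  rw [show m + 1 - 1 = m by omega, show j + 2 = (j + 1) + 1 by ring, choose_two_succ (j + 1),
    choose_two_succ j]
  push_cast
  ring

/-! ## Under rotational invariance `U' = U − 2J` -/

/-- `U_eff = U − 3J` for a less-than-half-filled shell.
[cite: GeorgesMediciMravlje2013, §3 («U_eff = U − 3J plays the role of the effective Hubbard
interaction (which is seen to be reduced by J)»); §2 (`U' = U − 2J`)] -/
theorem atomicGap_below_rot (U U' J : ℝ) (hU' : U' = U - 2 * J) {M n : ℕ} (h : n + 2 ≤ M) :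
    atomicGap U U' J M (n + 1) = U - 3 * J := by
  rw [atomicGap_below U U' J h, hU']
  ring

/-- `U_eff = U − 3J` for a more-than-half-filled shell.
[cite: GeorgesMediciMravlje2013, §3 (same equation, `N > M`)] -/
theorem atomicGap_above_rot (U U' J : ℝ) (hU' : U' = U - 2 * J) {M k : ℕ} (hk1 : 1 ≤ k)
    (hk : k + 1 ≤ M) : atomicGap U U' J M (M + k) = U - 3 * J := by
  rw [atomicGap_above U U' J hk1 hk, hU']
  ring

/-- The «Janus» contrast: the half-filled gap exceeds the generic one by `(M + 2)J`
(`U + (M−1)J` versus `U − 3J`). [cite: GeorgesMediciMravlje2013, §3 («In contrast to a generic filling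
N ≠ M, the intra-atomic gap (or effective U) is increased by Hund's coupling for a half-filled shell»)] -/
theorem janus (U U' J : ℝ) (hU' : U' = U - 2 * J) {M n : ℕ} (h : n + 2 ≤ M) :
    atomicGap U U' J M M - atomicGap U U' J M (n + 1) = ((M : ℝ) + 2) * J := by
  rw [atomicGap_half U U' J (by omega : 1 ≤ M), atomicGap_below_rot U U' J hU' h]
  ring

/-- The printed ground-state energy below half filling, `E₀(N) = (U − 3J)·N(N−1)/2` (`N ≤ M`,
`U' = U − 2J`). [cite: GeorgesMediciMravlje2013, §3 («E₀(N) = (U' − J)N(N−1)/2 = (U−3J)N(N−1)/2»)] -/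
theorem groundEnergy_le_rot (U U' J : ℝ) (hU' : U' = U - 2 * J) {M N : ℕ} (h : N ≤ M) :
    ddEnergy U U' J M (hund M N) = (U - 3 * J) * ((N : ℝ) * ((N : ℝ) - 1) / 2) := by
  rw [ddEnergy_hund_le U U' J h, cast_choose_two, hU']
  ring

/-- The printed energy of the first state above half filling,
`E₀(M+1) = (U' − J)·M(M−1)/2 + U·1 + U'·(M−1)` (`M ≥ 1`).
[cite: GeorgesMediciMravlje2013, §3 («E₀(M+1) = (U' − J)×M(M−1)/2 + U×1 + U'×(M−1)»)] -/
theorem groundEnergy_succ_half (U U' J : ℝ) {M : ℕ} (hM : 1 ≤ M) :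
    ddEnergy U U' J M (hund M (M + 1))
      = (U' - J) * ((M : ℝ) * ((M : ℝ) - 1) / 2) + U * 1 + U' * ((M : ℝ) - 1) := by
  obtain ⟨m, rfl⟩ : ∃ m, M = m + 1 := ⟨M - 1, by omega⟩
  have h12 : Nat.choose 1 2 = 0 := by decide
  rw [ddEnergy_hund_ge U U' J (by omega : 1 ≤ m + 1), h12, add_zero, show m + 1 - 1 = m by omega]
  push_cast
  rw [cast_choose_two]
  push_cast
  ring

/-! ## The printed Mott criteria (atomic gap against a kinetic scale `W̃`) -/

/-- Generic filling: `Δ_at = W̃ ⟺ U = W̃ + 3J` («`U_c = W̃_{M,N}(J) + 3J` for a non half-filled shell»).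
[cite: GeorgesMediciMravlje2013, §3] -/
theorem mottCriterion_generic (U U' J W : ℝ) (hU' : U' = U - 2 * J) {M n : ℕ} (h : n + 2 ≤ M) :
    atomicGap U U' J M (n + 1) = W ↔ U = W + 3 * J := by
  rw [atomicGap_below_rot U U' J hU' h]
  constructor <;> intro h1 <;> linarith

/-- Half filling: `Δ_at = W̃ ⟺ U = W̃ − (M − 1)J` («`U_c = W̃_{M,M}(J) − (M−1)J` at half-filling»).
[cite: GeorgesMediciMravlje2013, §3] -/
theorem mottCriterion_half (U U' J W : ℝ) {M : ℕ} (hM : 1 ≤ M) :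
    atomicGap U U' J M M = W ↔ U = W - ((M : ℝ) - 1) * J := by
  rw [atomicGap_half U U' J hM]
  constructor <;> intro h1 <;> linarith

/-! ## Witnesses: the `t₂g` shell and the d shell -/

/-- `t₂g` (`M = 3`), rotationally invariant: `Δ_at(N) = U − 3J` for `N = 1, 2, 4, 5` and `U + 2J` for
`N = 3`. [cite: GeorgesMediciMravlje2013, §3 (Fig. `U_c` vs `J` for three orbitals: `N = 1, 2` vs `N = 3`)] -/
theorem t2g_gaps (U U' J : ℝ) (hU' : U' = U - 2 * J) :
    atomicGap U U' J 3 1 = U - 3 * J ∧ atomicGap U U' J 3 2 = U - 3 * J ∧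
    atomicGap U U' J 3 3 = U + 2 * J ∧ atomicGap U U' J 3 4 = U - 3 * J ∧
    atomicGap U U' J 3 5 = U - 3 * J := by
  refine ⟨atomicGap_below_rot U U' J hU' (by norm_num : 0 + 2 ≤ 3),
    atomicGap_below_rot U U' J hU' (by norm_num : 1 + 2 ≤ 3), ?_,
    atomicGap_above_rot U U' J hU' (k := 1) (by norm_num) (by norm_num),
    atomicGap_above_rot U U' J hU' (k := 2) (by norm_num) (by norm_num)⟩
  rw [atomicGap_half U U' J (by norm_num : 1 ≤ 3)]
  push_cast
  ring

/-- The d shell (`M = 5`), rotationally invariant: `Δ_at = U − 3J` at `N = 6` (d⁶: generic filling) and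
`U + 4J` at `N = 5` (d⁵: half filling). [cite: GeorgesMediciMravlje2013, §3] -/
theorem dshell_gaps (U U' J : ℝ) (hU' : U' = U - 2 * J) :
    atomicGap U U' J 5 6 = U - 3 * J ∧ atomicGap U U' J 5 5 = U + 4 * J := by
  refine ⟨atomicGap_above_rot U U' J hU' (k := 1) (by norm_num) (by norm_num), ?_⟩
  rw [atomicGap_half U U' J (by norm_num : 1 ≤ 5)]
  push_cast
  ring

end KanamoriAtomicMottGap

end Literature.MathematicalPhysics.QuantumManyBody

end
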